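import Summits.ResolutionOfSingularities.ResolutionOfSingularities.Theorems.WeightedInvariantIota3RowBBalanceCore

/-!
# (F-3h) EVERY FACE TAIL, EVERY COMPETING FLAG — Row B with the balance  [OURS · L1 W4.3]

Kernel infrastructure for RE-ENTRY OBJECT #1 of chain w43 (door crux `stmt-ResolutionOfSingularities-19897`),
rung (F-3h), closing res-D-brk-1's §7 for the face `Y^p + ΛV^d`: the germs
`f = y^p + Λ v^d + Σ_j γ_j x^{c_j} v^{b_j} + x^M` with ARBITRARY on-face mixed terms (`q c_j + r₂ b_j = N`,
`1 ≤ b_j < d`).  The hypotheses of `RowA.rowB_core_anyFrame_balance` hold for such tails: Frobenius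
(`coeff_face_nsmul_single`), (α) (`lt_weightedOrder_face`), (β) for `ρ < r₂` by plain weights
(`lt_weightedOrder_face_sub_pClassComponent`), and the balance coefficient (`coeff_face_balance`: the `b = d − 1`
term `x^c v^{d−1}` has `c ≥ 2`, so no `X₁X₀^{(d−1)m₀}`-coefficient by `coeff_add_mul_of_initialMonomial`).
Final: `face_secondMember_mem_anyFrame`, **`face_secondMember_mem_of_isTwoFlag`**.

[OURS · L1 W4.3] NOT a statement of the manuscript; AI-produced, gate-checked, weaker than expert review.
-/

set_option linter.dupNamespace false

namespace Summit.ResolutionOfSingularities.ResolutionOfSingularities.Theorems.LocalEngine.Iota3.RowA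

open MvPowerSeries IsLocalRing
open Summit.ResolutionOfSingularities.ResolutionOfSingularities.Theorems.LocalEngine.Iota3.PClass
open Summit.ResolutionOfSingularities.ResolutionOfSingularities.Cruxes.HypersurfaceCentreConstruction.LocalEngine.Iota3
open Literature.AlgebraicGeometry.Resolution.FormalCoordChange

variable {K : Type*} [Field K] {ι : Type*}

/-! ## The hypotheses for face tails -/

/-- (Frobenius hypothesis) a class-`0` face tail has no coefficient at the exponents `p·e_i`. -/
theorem coeff_face_nsmul_single (p : ℕ) {d q r₁ r₂ N : ℕ} (hN₁ : p * r₁ = N) (hq1 : q < r₁) (hr : r₂ < r₁)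
    (J : Finset ι) (γ : ι → K) (c b : ι → ℕ)
    (hJ : ∀ j ∈ J, 1 ≤ b j ∧ b j < d ∧ q * c j + r₂ * b j = N)
    {x v : MvPowerSeries (Fin 3) K} (hx0 : constantCoeff x = 0) (hv0 : constantCoeff v = 0) (i : Fin 3) :
    coeff (p • Finsupp.single i 1) (∑ j ∈ J, C (γ j) * (x ^ c j * v ^ b j)) = 0 := by
  rw [map_sum]
  refine Finset.sum_eq_zero fun j hj => ?_
  obtain ⟨hb, -, hface⟩ := hJ j hj
  rw [coeff_C_mul, coeff_of_lt_order, mul_zero]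
  refine lt_of_lt_of_le ?_ le_order_mul
  refine lt_of_lt_of_le ?_ (add_le_add (le_order_pow_of_constantCoeff_eq_zero (c j) hx0)
    (le_order_pow_of_constantCoeff_eq_zero (b j) hv0))
  rw [degree_nsmul_single]
  exact_mod_cast lt_add_of_face hN₁ hq1 hr hb hface

/-- (Hypothesis (α)) a class-`0` face tail weighs more than `d·a` when `W(v) = a < r₂`. -/
theorem lt_weightedOrder_face {d q r₁ r₂ N : ℕ} (hqr : q < r₂) (hr : r₂ ≤ r₁) (hN₂ : d * r₂ = N)
    (J : Finset ι) (γ : ι → K) (c b : ι → ℕ)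
    (hJ : ∀ j ∈ J, 1 ≤ b j ∧ b j < d ∧ q * c j + r₂ * b j = N)
    {x v : MvPowerSeries (Fin 3) K} (hx0 : constantCoeff x = 0) (a : ℕ)
    (hWv : v.weightedOrder ![q, r₂, r₁] = (a : ℕ∞)) (ha : a < r₂) :
    (((d * a : ℕ)) : ℕ∞) < (∑ j ∈ J, C (γ j) * (x ^ c j * v ^ b j)).weightedOrder ![q, r₂, r₁] := by
  have hle : (((d * a + 1 : ℕ)) : ℕ∞) ≤ (∑ j ∈ J, C (γ j) * (x ^ c j * v ^ b j)).weightedOrder ![q, r₂, r₁] := by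
    refine nat_le_weightedOrder _ fun e he => ?_
    rw [map_sum]
    refine Finset.sum_eq_zero fun j hj => ?_
    obtain ⟨-, hbd, hface⟩ := hJ j hj
    rw [coeff_C_mul, coeff_eq_zero_of_lt_weightedOrder (![q, r₂, r₁]), mul_zero]
    refine lt_of_lt_of_le ?_ (le_weightedOrder_pow_mul hqr.le hr hx0 (c j) (v ^ b j))
    have hvb : (((b j * a : ℕ)) : ℕ∞) ≤ (v ^ b j).weightedOrder ![q, r₂, r₁] := by
      refine le_trans ?_ (le_weightedOrder_pow _ (b j))
      rw [hWv, nsmul_eq_mul, Nat.cast_mul]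
    refine lt_of_lt_of_le ?_ (add_le_add le_rfl hvb)
    have hnum : d * a < c j * q + b j * a := by
      obtain ⟨δ, hδ⟩ := Nat.exists_eq_add_of_lt hbd
      obtain ⟨ε, hε⟩ := Nat.exists_eq_add_of_lt ha
      subst hδ; subst hε
      nlinarith
    exact_mod_cast lt_of_lt_of_le he (Nat.succ_le_of_lt hnum)
  exact lt_of_lt_of_le (by exact_mod_cast Nat.lt_succ_self _) hle

/-- (Hypothesis (β), strict branch) for `W(v_0) = a < ρ = W(v − v_0) < r₂` every face term weighs more than
`(d−1)a + ρ` by its plain weight `q c + b a` — no class condition. -/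
theorem lt_weightedOrder_face_sub_pClassComponent (p : ℕ) [Fact p.Prime] [CharP K p] {d q r₁ r₂ N : ℕ}
    (hqr : q < r₂) (hr : r₂ ≤ r₁) (hN₂ : d * r₂ = N) (J : Finset ι) (γ : ι → K) (c b : ι → ℕ)
    (hJ : ∀ j ∈ J, 1 ≤ b j ∧ b j < d ∧ q * c j + r₂ * b j = N)
    {x v : MvPowerSeries (Fin 3) K} (hx0 : constantCoeff x = 0) (a ρ : ℕ)
    (hWG : (pClassComponent p 0 v).weightedOrder ![q, r₂, r₁] = (a : ℕ∞))
    (hWR : (v - pClassComponent p 0 v).weightedOrder ![q, r₂, r₁] = (ρ : ℕ∞)) (ha : a < r₂) (haρ : a < ρ)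
    (hρ : ρ < r₂) :
    ((((d - 1) * a + ρ : ℕ)) : ℕ∞) <
      (∑ j ∈ J, C (γ j) * (x ^ c j * v ^ b j) -
        pClassComponent p 0 (∑ j ∈ J, C (γ j) * (x ^ c j * v ^ b j))).weightedOrder ![q, r₂, r₁] := by
  haveI : NeZero p := ⟨(Fact.out : p.Prime).ne_zero⟩
  have hdiff : ∑ j ∈ J, C (γ j) * (x ^ c j * v ^ b j) - pClassComponent p 0 (∑ j ∈ J, C (γ j) * (x ^ c j * v ^ b j)) =
      ∑ j ∈ J, C (γ j) * (x ^ c j * v ^ b j - pClassComponent p 0 (x ^ c j * v ^ b j)) := by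
    rw [pClassComponent_sum, ← Finset.sum_sub_distrib]
    refine Finset.sum_congr rfl fun j _ => ?_
    rw [pClassComponent_C_mul, mul_sub]
  have hWv : (a : ℕ∞) ≤ v.weightedOrder ![q, r₂, r₁] := by
    have h := min_weightedOrder_le_add (w := ![q, r₂, r₁]) (f := v - pClassComponent p 0 v) (g := pClassComponent p 0 v)
    rw [sub_add_cancel, hWG, hWR] at h
    exact le_trans (le_min (by exact_mod_cast haρ.le) le_rfl) h
  rw [hdiff]
  have hle : ((((d - 1) * a + ρ + 1 : ℕ)) : ℕ∞) ≤
      (∑ j ∈ J, C (γ j) * (x ^ c j * v ^ b j - pClassComponent p 0 (x ^ c j * v ^ b j))).weightedOrder ![q, r₂, r₁] := by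
    refine nat_le_weightedOrder _ fun e he => ?_
    rw [map_sum]
    refine Finset.sum_eq_zero fun j hj => ?_
    obtain ⟨hb1, hbd, hface⟩ := hJ j hj
    rw [coeff_C_mul, coeff_eq_zero_of_lt_weightedOrder (![q, r₂, r₁]), mul_zero]
    refine lt_of_lt_of_le ?_ (le_weightedOrder_sub_pClassComponent _ p 0 _)
    refine lt_of_lt_of_le ?_ (le_weightedOrder_pow_mul hqr.le hr hx0 (c j) _)
    have hvb : (((b j * a : ℕ)) : ℕ∞) ≤ (v ^ b j).weightedOrder ![q, r₂, r₁] := by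
      refine le_trans ?_ (le_weightedOrder_pow _ (b j))
      rw [Nat.cast_mul, nsmul_eq_mul]
      gcongr
    refine lt_of_lt_of_le ?_ (add_le_add le_rfl hvb)
    have hnum : (d - 1) * a + ρ < c j * q + b j * a := by
      obtain ⟨δ, hδ⟩ := Nat.exists_eq_add_of_lt hbd
      obtain ⟨ε, hε⟩ := Nat.exists_eq_add_of_lt ha
      subst hδ; subst hε
      rw [show b j + δ + 1 - 1 = b j + δ by omega]
      nlinarith [hface, hρ]
    exact_mod_cast lt_of_lt_of_le he (Nat.succ_le_of_lt hnum)
  exact lt_of_lt_of_le (by exact_mod_cast Nat.lt_succ_self _) hle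

/-- (The balance coefficient) every face tail has zero coefficient at `E = X₁ X₀^{(d−1)m₀}` in its non-class-`0`
part, when `v` has the single initial monomial `X₀^{m₀}` (`q m₀ < r₂`): terms with `b ≤ d − 2` by weight, the
`b = d − 1` term `x^c v^{d−1}` because `x^c` (`c ≥ 2`) has no linear term and `v^{d−1}` has the single initial
monomial `X₀^{(d−1)m₀}`. -/
theorem coeff_face_balance (p : ℕ) [Fact p.Prime] [CharP K p] {d q r₁ r₂ N : ℕ} (hqr : q < r₂) (hr : r₂ ≤ r₁)
    (hN₂ : d * r₂ = N) (J : Finset ι) (γ : ι → K) (c b : ι → ℕ)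
    (hJ : ∀ j ∈ J, 1 ≤ b j ∧ b j < d ∧ q * c j + r₂ * b j = N)
    {x v : MvPowerSeries (Fin 3) K} (hx0 : constantCoeff x = 0) {m₀ : ℕ}
    (hcm : coeff (Finsupp.single 0 m₀) v ≠ 0)
    (hini : ∀ e, coeff e v ≠ 0 → e ≠ Finsupp.single 0 m₀ →
      Finsupp.weight ![q, r₂, r₁] (Finsupp.single 0 m₀) < Finsupp.weight ![q, r₂, r₁] e)
    (ham : q * m₀ < r₂) :
    coeff (Finsupp.single 1 1 + Finsupp.single 0 ((d - 1) * m₀))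
      (∑ j ∈ J, C (γ j) * (x ^ c j * v ^ b j) - pClassComponent p 0 (∑ j ∈ J, C (γ j) * (x ^ c j * v ^ b j))) = 0 := by
  classical
  haveI : NeZero p := ⟨(Fact.out : p.Prime).ne_zero⟩
  haveI : Fact (1 < p) := ⟨(Fact.out : p.Prime).one_lt⟩
  have hWv : v.weightedOrder ![q, r₂, r₁] = ((q * m₀ : ℕ) : ℕ∞) := by
    rw [weightedOrder_eq_of_initialMonomial _ hcm hini, weight_single_zero]
  have hclE : exponentClass p (Finsupp.single (1 : Fin 3) 1 + Finsupp.single 0 ((d - 1) * m₀)) ≠ 0 := fun h => by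
    have h1 := congr_fun h 1
    rw [exponentClass_apply, Finsupp.add_apply, Finsupp.single_eq_same,
      Finsupp.single_eq_of_ne (show (1 : Fin 3) ≠ 0 by decide), add_zero, Nat.cast_one, Pi.zero_apply] at h1
    exact one_ne_zero h1
  rw [coeff_sub_pClassComponent_of_ne hclE, map_sum]
  refine Finset.sum_eq_zero fun j hj => ?_
  obtain ⟨hb1, hbd, hface⟩ := hJ j hj
  rw [coeff_C_mul]
  rcases Nat.lt_or_ge (b j + 1) d with hlt | hge
  · -- `b ≤ d − 2`: weight
    rw [coeff_eq_zero_of_lt_weightedOrder (![q, r₂, r₁]), mul_zero]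
    refine lt_of_lt_of_le ?_ (le_weightedOrder_pow_mul hqr.le hr hx0 (c j) _)
    have hvb : (((b j * (q * m₀) : ℕ)) : ℕ∞) ≤ (v ^ b j).weightedOrder ![q, r₂, r₁] := by
      refine le_trans ?_ (le_weightedOrder_pow _ (b j))
      rw [hWv, nsmul_eq_mul, Nat.cast_mul]
    refine lt_of_lt_of_le ?_ (add_le_add le_rfl hvb)
    rw [weight_single_one_add]
    have hnum : r₂ + q * ((d - 1) * m₀) < c j * q + b j * (q * m₀) := by
      obtain ⟨δ, hδ⟩ := Nat.exists_eq_add_of_lt hlt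
      obtain ⟨ε, hε⟩ := Nat.exists_eq_add_of_lt ham
      subst hδ
      rw [show b j + 1 + δ + 1 - 1 = b j + δ + 1 by omega]
      nlinarith [hface, hε]
    exact_mod_cast hnum
  · -- `b = d − 1`: extraction
    have hbd1 : b j = d - 1 := by omega
    have hqc : q * c j = r₂ := by
      have h : q * c j + r₂ * b j = (b j + 1) * r₂ := by rw [hface, ← hN₂]; congr 1; omega
      nlinarith
    have hc2 : 2 ≤ c j := by
      by_contra h
      push Not at h
      interval_cases (c j) <;> omega
    have hB : Finsupp.single (0 : Fin 3) ((d - 1) * m₀) = (d - 1) • Finsupp.single 0 m₀ := by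
      rw [Finsupp.smul_single, smul_eq_mul]
    rw [hbd1, coeff_add_mul_of_initialMonomial (![q, r₂, r₁]) ?_ ?_,
      coeff_pow_eq_zero_of_degree_lt hx0 (by rw [Finsupp.degree_single]; omega), zero_mul, mul_zero]
    · have h := le_weightedOrder_pow_mul hqr.le hr hx0 (c j) (1 : MvPowerSeries (Fin 3) K)
      rw [mul_one, weightedOrder_one, add_zero] at h
      rw [weight_single_one]
      calc (r₂ : ℕ∞) = ((c j * q : ℕ) : ℕ∞) := by rw [← hqc, mul_comm]
        _ ≤ _ := h
    · intro B' hB' hne'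
      rw [hB] at hne' ⊢
      exact initialMonomial_pow (![q, r₂, r₁]) hini (d - 1) B' hB' hne'

/-! ## Every face tail, in an arbitrary frame and against every flag -/

/-- **EVERY FACE TAIL, ARBITRARY FRAME**: for any frame `(x, v, y)` of `K⟦X₀,X₁,X₂⟧`,
`y^p + Λ v^d + Σ_j γ_j x^{c_j} v^{b_j} + x^M ∈ F_{(X₂;X₁)}(N) ⇒ v ∈ F_{(X₂;X₁)}(r₂)` (`1 ≤ b_j < d`, `q c_j + r₂ b_j = N`). -/
theorem face_secondMember_mem_anyFrame (p : ℕ) [Fact p.Prime] [CharP K p] (d M q r₁ r₂ N : ℕ)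
    (hpd : ¬ p ∣ d) (hlt : p < d) (hN₁ : p * r₁ = N) (hN₂ : d * r₂ = N) (hN₃ : M * q = N) (hq : 0 < q)
    (hqr : q < r₂) (Λ : K) (hΛ : Λ ≠ 0) (J : Finset ι) (γ : ι → K) (c b : ι → ℕ)
    (hJ : ∀ j ∈ J, 1 ≤ b j ∧ b j < d ∧ q * c j + r₂ * b j = N) (x y v : MvPowerSeries (Fin 3) K)
    (hframe : Ideal.span {x, v, y} = maximalIdeal (MvPowerSeries (Fin 3) K))
    (hreach : y ^ p + C Λ * v ^ d + (∑ j ∈ J, C (γ j) * (x ^ c j * v ^ b j)) + x ^ M ∈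
      flagContactFiltration (X 2 : MvPowerSeries (Fin 3) K) (X 1) q r₁ r₂ N) :
    v ∈ flagContactFiltration (X 2 : MvPowerSeries (Fin 3) K) (X 1) q r₁ r₂ r₂ := by
  have hp : p.Prime := Fact.out
  have hr₂ : 0 < r₂ := by omega
  have hr₂r₁ : r₂ < r₁ := by
    by_contra h
    push Not at h
    have h1 : p * r₁ ≤ p * r₂ := Nat.mul_le_mul_left _ h
    have h2 : p * r₂ < d * r₂ := Nat.mul_lt_mul_of_pos_right hlt hr₂
    omega
  have hadm : AdmissibleTriple q r₁ r₂ := ⟨hq, hqr.le, hr₂r₁.le⟩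
  have hmem : ∀ g ∈ ({x, v, y} : Set (MvPowerSeries (Fin 3) K)), constantCoeff g = 0 := fun g hg =>
    constantCoeff_eq_zero_of_mem_maximalIdeal (hframe ▸ Ideal.subset_span hg)
  have hx0 : constantCoeff x = 0 := hmem x (by simp)
  have hv0 : constantCoeff v = 0 := hmem v (by simp)
  have hXi : ∀ i : Fin 3, (X i : MvPowerSeries (Fin 3) K) ∈ Ideal.span {x, v, y} := fun i =>
    hframe ▸ mem_maximalIdeal_of_constantCoeff_eq_zero (constantCoeff_X i)
  rw [mem_flagContactFiltration_X_iff hadm] at hreach ⊢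
  exact rowB_core_anyFrame_balance p hpd hlt hN₁ hN₂ hN₃ hq hqr hΛ hx0 hv0 (hmem y (by simp)) (hXi 0) (hXi 1)
    (coeff_face_nsmul_single p hN₁ (hqr.trans hr₂r₁) hr₂r₁ J γ c b hJ hx0 hv0)
    (fun a hWv ha => lt_weightedOrder_face hqr hr₂r₁.le hN₂ J γ c b hJ hx0 a hWv ha)
    (fun a ρ hWG hWR ha haρ hρ =>
      lt_weightedOrder_face_sub_pClassComponent p hqr hr₂r₁.le hN₂ J γ c b hJ hx0 a ρ hWG hWR ha haρ hρ)
    (fun m₀ hcm hini ham _ _ => coeff_face_balance p hqr hr₂r₁.le hN₂ J γ c b hJ hx0 hcm hini ham) hreach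

/-- **ROWS A AND B TOGETHER: EVERY FACE TAIL, EVERY COMPETING FLAG** [OURS · L1 W4.3 · (F-3h)].  For a field
`K` of characteristic `p` and ANY germ `f = X₂^p + Λ X₁^d + Σ_j γ_j X₀^{c_j} X₁^{b_j} + X₀^M` whose Newton face is the
segment `Y^p + ΛV^d` (`p ∤ d`, `p < d`, `Λ ≠ 0`, `N = p r₁ = d r₂ = M q`, `0 < q < r₂`) decorated with arbitrary on-face
monomials (`q c_j + r₂ b_j = N`, `1 ≤ b_j < d`, no condition on `c_j`): every two-flag `(y'; v')` with
`f ∈ F_{(y';v')}^{(q;r₁,r₂)}(N)` has `X₁ ∈ F_{(y';v')}^{(q;r₁,r₂)}(r₂)` — second-member dominance, the balance case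
(brk-1's `x⁵v²`) included. -/
theorem face_secondMember_mem_of_isTwoFlag (p : ℕ) [Fact p.Prime] {K : Type*} [Field K] [CharP K p]
    (d M q r₁ r₂ N : ℕ) (hpd : ¬ p ∣ d) (hlt : p < d) (hN₁ : p * r₁ = N) (hN₂ : d * r₂ = N) (hN₃ : M * q = N)
    (hq : 0 < q) (hqr : q < r₂) (Λ : K) (hΛ : Λ ≠ 0) {ι : Type*} (J : Finset ι) (γ : ι → K) (c b : ι → ℕ)
    (hJ : ∀ j ∈ J, 1 ≤ b j ∧ b j < d ∧ q * c j + r₂ * b j = N)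
    (y' v' : MvPowerSeries (Fin 3) K) (hflag : IsTwoFlag y' v')
    (hreach : (X 2 : MvPowerSeries (Fin 3) K) ^ p + C Λ * X 1 ^ d +
        (∑ j ∈ J, C (γ j) * ((X 0 : MvPowerSeries (Fin 3) K) ^ c j * X 1 ^ b j)) + X 0 ^ M ∈
      flagContactFiltration y' v' q r₁ r₂ N) :
    (X 1 : MvPowerSeries (Fin 3) K) ∈ flagContactFiltration y' v' q r₁ r₂ r₂ := by
  obtain ⟨i, hdet⟩ := exists_isUnit_det_of_isTwoFlag hflag
  set θ : Fin 3 → MvPowerSeries (Fin 3) K := ![(X i : MvPowerSeries (Fin 3) K), v', y'] with hθ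
  have hv0 : constantCoeff v' = 0 := constantCoeff_eq_zero_of_mem_maximalIdeal hflag.2.1
  have hy0 : constantCoeff y' = 0 := constantCoeff_eq_zero_of_mem_maximalIdeal hflag.1
  have h0 : ∀ j, constantCoeff (θ j) = 0 := by
    intro j; fin_cases j
    · exact constantCoeff_X i
    · exact hv0
    · exact hy0
  have hθs : HasSubst θ := hasSubst_of_constantCoeff_zero h0
  obtain ⟨e, he⟩ := exists_ringEquiv_subst h0 hdet
  have he1 : e (X 1) = v' := by rw [he, subst_X hθs]; rfl
  have he2 : e (X 2) = y' := by rw [he, subst_X hθs]; rfl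
  have heC : ∀ a : K, e (C a) = C a := fun a => by rw [he, subst_C]
  set ψ := e.symm with hψ
  have hψv : ψ v' = X 1 := by rw [hψ, RingEquiv.symm_apply_eq, he1]
  have hψy : ψ y' = X 2 := by rw [hψ, RingEquiv.symm_apply_eq, he2]
  have hψC : ∀ a : K, ψ (C a) = C a := fun a => by rw [hψ, RingEquiv.symm_apply_eq, heC]
  have hψsum : ψ (∑ j ∈ J, C (γ j) * ((X 0 : MvPowerSeries (Fin 3) K) ^ c j * X 1 ^ b j)) =
      ∑ j ∈ J, C (γ j) * (ψ (X 0) ^ c j * ψ (X 1) ^ b j) := by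
    rw [map_sum]
    refine Finset.sum_congr rfl fun j _ => ?_
    rw [map_mul, map_mul, map_pow, map_pow, hψC]
  have hreach' : (ψ (X 2)) ^ p + C Λ * (ψ (X 1)) ^ d + (∑ j ∈ J, C (γ j) * (ψ (X 0) ^ c j * ψ (X 1) ^ b j)) +
      (ψ (X 0)) ^ M ∈ flagContactFiltration (X 2 : MvPowerSeries (Fin 3) K) (X 1) q r₁ r₂ N := by
    have h := (apply_mem_flagContactFiltration_iff ψ ((X 2 : MvPowerSeries (Fin 3) K) ^ p + C Λ * X 1 ^ d +
      (∑ j ∈ J, C (γ j) * ((X 0 : MvPowerSeries (Fin 3) K) ^ c j * X 1 ^ b j)) + X 0 ^ M) y' v' q r₁ r₂ N).mpr hreach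
    rwa [hψy, hψv, map_add, map_add, map_add, map_pow, map_mul, map_pow, map_pow, hψC, hψsum] at h
  have hframe' : Ideal.span {ψ (X 0), ψ (X 1), ψ (X 2)} = maximalIdeal (MvPowerSeries (Fin 3) K) := by
    rw [← map_ringEquiv_maximalIdeal ψ, maximalIdeal_eq_span_triple, Ideal.map_span, Set.image_insert_eq,
      Set.image_insert_eq, Set.image_singleton]
  have h := face_secondMember_mem_anyFrame p d M q r₁ r₂ N hpd hlt hN₁ hN₂ hN₃ hq hqr Λ hΛ J γ c b hJ
    (ψ (X 0)) (ψ (X 2)) (ψ (X 1)) hframe' hreach'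
  have h' := apply_mem_flagContactFiltration_iff ψ (X 1 : MvPowerSeries (Fin 3) K) y' v' q r₁ r₂ r₂
  rw [hψy, hψv] at h'
  exact h'.mp h

end Summit.ResolutionOfSingularities.ResolutionOfSingularities.Theorems.LocalEngine.Iota3.RowA
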